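import Literature.AlgebraicGeometry.ShimuraVarieties.UnitaryBallLocalBiholomorphy
import Literature.AlgebraicGeometry.ShimuraVarieties.UnitaryBallHolomorphicPullback
import Literature.NumberTheory.Transcendental.FormIntegrationCharts
import Literature.Analysis.Complex.OsgoodProofs

/-!
# Descent of holomorphic automorphic forms on the ball to holomorphic forms on `X^an`

For a ball uniformization `D : UnitaryBallUniformisationDatum 2 X₂` of a smooth projective surface, a
Hodge model `A : HodgeModel 2 X₂` (the complex manifold `X^an`) and a Sylvester frame `𝔣`, with
`ψ = D.modelUnif A 𝔣 : 𝔹² → X^an`, the pull-backs `Ω¹(X^an) → 𝒜_hol(Γ, J⁻ᵀ)` (`holFormPullback₁`)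
and `Ω²(X^an) → 𝒜_hol(Γ, det J⁻¹)` (`holFormPullback₂`) of `UnitaryBallHolomorphicPullback` are
**surjective** (`holFormPullback₁_surjective`, `holFormPullback₂_surjective`).

Construction. `ψ` is a local biholomorphism (`UnitaryBallLocalBiholomorphy`: `unifDerivEquiv`,
`ChartInverse`). A holomorphic `F : 𝔹² → ℂ²` with `F(z) = J(γ,z)ᵀ F(γ z)` defines at each ball
point the covector `η̃_z = Σᵢ Fᵢ(z) dzᵢ ∘ (dψ_z)⁻¹` on `T_{ψ z} X^an` (`descForm₁`); automorphy and
`(dψ_{γ z})⁻¹ = J(γ, z) (dψ_z)⁻¹` give `η̃_{γ z} = η̃_z` (`descForm₁_smul`), so `η_x := η̃_z` (any `z`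
over `x`) is a `1`-form on `X^an` (`descMForm₁`, `descMForm₁_modelUnif`). In the chart at
`x = ψ z`, with `g` the holomorphic local inverse of `ψ` (`c⁻¹ = ψ ∘ g`), its representative is
`y ↦ Σᵢ Fᵢ(g y) dzᵢ ∘ dg_y`, the restriction of scalars of a complex-differentiable — hence, by
Osgood's lemma (`SCV.analyticAt_of_differentiableOn`), analytic — germ of `ℂ`-linear forms: `η` is
holomorphic in charts (`isHolomorphicInCharts_descMForm₁`), and `ψ^* η = F`
(`formPullback₁_descMForm₁`). Degree `2`: `G(z) (dz₀ ∧ dz₁) ∘ (dψ_z)⁻¹`, `G(z) = det J(γ,z) G(γ z)`.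
This is the ball case of the dictionary "holomorphic automorphic forms of weight `J⁻ᵀ` /
`det J⁻¹` = holomorphic `1`- / `2`-forms on `Γ\𝔹²`" (Borel (1997), §5.14 for `Γ\ℍ`; Hirzebruch
(1966), §22.2 for ball quotients). All statements are theorems.

References: A. Borel, *Automorphic forms on `SL₂(ℝ)`* (1997), §5.14; F. Hirzebruch,
*Topological Methods in Algebraic Geometry* (1966), §22.2; C. Voisin, *Hodge Theory and Complex
Algebraic Geometry I* (2002), §2.3.1.

## Provenance

Written under the LEAN-IN-TREE rule for the pub-hodgecm formalisation cell (model-construction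
sub-cell, seat mc-autform-1 gen 2, MODEL-DAG node D1-G-iii-c, step K3: the kernel proof of the
registry rows N-D4-1 / N-D4-2). Nothing in this file is a claim of the manuscripts adjudicated by
that cell.
-/

noncomputable section

open Matrix MulAction Function Set Filter Complex
open scoped Manifold Topology
open Literature.Geometry.ComplexHyperbolic
open Literature.Geometry.ComplexHyperbolic.BallModel (U21 Ball Jac nsq)
open Literature.Geometry.Kaehler (MForm IsHolomorphicInCharts holFormsInCharts)
open Literature.NumberTheory.Transcendental
open Literature.NumberTheory.Automorphic.AutomorphyFactor
open Literature.AlgebraicGeometry.HodgeTheory (HodgeModel)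
open Literature.Analysis.Complex

namespace Literature.AlgebraicGeometry.ShimuraVarieties

namespace BallForms

section ModelForms

variable {E : Type*} [NormedAddCommGroup E] [NormedSpace ℂ E]

/-- The linear form `u ↦ Σᵢ aᵢ uᵢ` on `ℂ²`. [folklore] -/
def dot (a : Fin 2 → ℂ) : (Fin 2 → ℂ) →L[ℂ] ℂ :=
  ∑ i, a i • ContinuousLinearMap.proj i

/-- Evaluation of `dot`. [folklore] -/
@[simp] theorem dot_apply (a u : Fin 2 → ℂ) : dot a u = ∑ i, a i * u i := by
  simp [dot]

/-- The real `1`-form `v ↦ Σᵢ aᵢ (S v)ᵢ` on `E` (the covector `Σ aᵢ dzᵢ` pulled back by the real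
linear map `S : E → ℂ²`). [folklore] -/
def covec (a : Fin 2 → ℂ) (S : E →L[ℝ] (Fin 2 → ℂ)) : E [⋀^Fin 1]→L[ℝ] ℂ :=
  ContinuousAlternatingMap.ofSubsingleton ℝ E ℂ (0 : Fin 1) (((dot a).restrictScalars ℝ).comp S)

/-- Evaluation of `covec`: `v ↦ Σᵢ aᵢ (S v₀)ᵢ`. [folklore] -/
@[simp] theorem covec_apply (a : Fin 2 → ℂ) (S : E →L[ℝ] (Fin 2 → ℂ)) (v : Fin 1 → E) :
    covec a S v = ∑ i, a i * S (v 0) i := by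
  simp [covec]

/-- The `ℂ`-linear `1`-form `v ↦ Σᵢ aᵢ (L v)ᵢ` on `E`. [folklore] -/
def covecℂ (a : Fin 2 → ℂ) (L : E →L[ℂ] (Fin 2 → ℂ)) : E [⋀^Fin 1]→L[ℂ] ℂ :=
  ContinuousAlternatingMap.ofSubsingleton ℂ E ℂ (0 : Fin 1) ((dot a).comp L)

/-- Evaluation of `covecℂ`. [folklore] -/
@[simp] theorem covecℂ_apply (a : Fin 2 → ℂ) (L : E →L[ℂ] (Fin 2 → ℂ)) (v : Fin 1 → E) :
    covecℂ a L v = ∑ i, a i * L (v 0) i := by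
  simp [covecℂ]

/-- `covecℂ a L` restricted to real scalars is `covec a L`. [folklore] -/
theorem restrictScalars_covecℂ (a : Fin 2 → ℂ) (L : E →L[ℂ] (Fin 2 → ℂ)) :
    (covecℂ a L).restrictScalars ℝ = covec a (L.restrictScalars ℝ) := by
  ext v
  simp [ContinuousAlternatingMap.coe_restrictScalars]

/-- The coordinate `1`-forms `dzᵢ` on `ℂ²` (real scalars). [folklore] -/
def dz (i : Fin 2) : (Fin 2 → ℂ) [⋀^Fin 1]→L[ℝ] ℂ :=
  ContinuousAlternatingMap.ofSubsingleton ℝ (Fin 2 → ℂ) ℂ (0 : Fin 1)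
    ((ContinuousLinearMap.proj i : (Fin 2 → ℂ) →L[ℂ] ℂ).restrictScalars ℝ)

/-- The coordinate `1`-forms `dzᵢ` on `ℂ²` (complex scalars). [folklore] -/
def dzℂ (i : Fin 2) : (Fin 2 → ℂ) [⋀^Fin 1]→L[ℂ] ℂ :=
  ContinuousAlternatingMap.ofSubsingleton ℂ (Fin 2 → ℂ) ℂ (0 : Fin 1) (ContinuousLinearMap.proj i)

/-- `dz₀ ∧ dz₁` on `ℂ²` (real scalars). [folklore] -/
def dzWedge : (Fin 2 → ℂ) [⋀^Fin 2]→L[ℝ] ℂ := (dz 0).wedge (dz 1)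

/-- `(dz₀ ∧ dz₁)(u₀, u₁) = u₀₀ u₁₁ - u₁₀ u₀₁`. [cite: Warner1983, 2.10(b)] -/
@[simp] theorem dzWedge_apply (u : Fin 2 → Fin 2 → ℂ) :
    dzWedge u = u 0 0 * u 1 1 - u 1 0 * u 0 1 := by
  rw [dzWedge, ContinuousAlternatingMap.wedge_apply_one_one]
  simp [dz]

/-- `dz₀ ∧ dz₁` on `ℂ²` (complex scalars). [folklore] -/
def dzWedgeℂ : (Fin 2 → ℂ) [⋀^Fin 2]→L[ℂ] ℂ := (dzℂ 0).wedge (dzℂ 1)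

/-- `(dz₀ ∧ dz₁)(u₀, u₁) = u₀₀ u₁₁ - u₁₀ u₀₁` (complex scalars). [cite: Warner1983, 2.10(b)] -/
@[simp] theorem dzWedgeℂ_apply (u : Fin 2 → Fin 2 → ℂ) :
    dzWedgeℂ u = u 0 0 * u 1 1 - u 1 0 * u 0 1 := by
  rw [dzWedgeℂ, ContinuousAlternatingMap.wedge_apply_one_one]
  simp [dzℂ]

/-- The real `2`-form `b · (dz₀ ∧ dz₁) ∘ S` on `E`. [folklore] -/
def twoForm (b : ℂ) (S : E →L[ℝ] (Fin 2 → ℂ)) : E [⋀^Fin 2]→L[ℝ] ℂ :=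
  b • dzWedge.compContinuousLinearMap S

/-- Evaluation of `twoForm`. [folklore] -/
@[simp] theorem twoForm_apply (b : ℂ) (S : E →L[ℝ] (Fin 2 → ℂ)) (v : Fin 2 → E) :
    twoForm b S v = b * (S (v 0) 0 * S (v 1) 1 - S (v 1) 0 * S (v 0) 1) := by
  simp [twoForm, ContinuousAlternatingMap.compContinuousLinearMap_apply, Function.comp_def]

/-- The `ℂ`-linear `2`-form `b · (dz₀ ∧ dz₁) ∘ L` on `E`. [folklore] -/
def twoFormℂ (b : ℂ) (L : E →L[ℂ] (Fin 2 → ℂ)) : E [⋀^Fin 2]→L[ℂ] ℂ :=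
  b • dzWedgeℂ.compContinuousLinearMap L

/-- Evaluation of `twoFormℂ`. [folklore] -/
@[simp] theorem twoFormℂ_apply (b : ℂ) (L : E →L[ℂ] (Fin 2 → ℂ)) (v : Fin 2 → E) :
    twoFormℂ b L v = b * (L (v 0) 0 * L (v 1) 1 - L (v 1) 0 * L (v 0) 1) := by
  simp [twoFormℂ, ContinuousAlternatingMap.compContinuousLinearMap_apply, Function.comp_def]

/-- `twoFormℂ b L` restricted to real scalars is `twoForm b L`. [folklore] -/
theorem restrictScalars_twoFormℂ (b : ℂ) (L : E →L[ℂ] (Fin 2 → ℂ)) :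
    (twoFormℂ b L).restrictScalars ℝ = twoForm b (L.restrictScalars ℝ) := by
  ext v
  simp [ContinuousAlternatingMap.coe_restrictScalars]

/-- **Differentiability of `y ↦ Σᵢ aᵢ(y) dzᵢ ∘ L(y)`** in the space of `ℂ`-linear `1`-forms.
[folklore] -/
theorem differentiableAt_covecℂ {X : Type*} [NormedAddCommGroup X] [NormedSpace ℂ X]
    {a : X → Fin 2 → ℂ} {L : X → E →L[ℂ] (Fin 2 → ℂ)} {y : X}
    (ha : DifferentiableAt ℂ a y) (hL : DifferentiableAt ℂ L y) :
    DifferentiableAt ℂ (fun y ↦ covecℂ (a y) (L y)) y := by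
  have hdot : DifferentiableAt ℂ (fun y ↦ dot (a y)) y := by
    have : (fun y ↦ dot (a y)) = fun y ↦ ∑ i, a y i • (ContinuousLinearMap.proj i :
        (Fin 2 → ℂ) →L[ℂ] ℂ) := rfl
    rw [this]
    exact DifferentiableAt.fun_sum fun i _ ↦
      ((ContinuousLinearMap.proj i : (Fin 2 → ℂ) →L[ℂ] ℂ).differentiableAt.comp y ha).smul
        (differentiableAt_const _)
  have hcomp : DifferentiableAt ℂ (fun y ↦ (dot (a y)).comp (L y)) y := hdot.clm_comp hL
  exact (ContinuousAlternatingMap.ofSubsingletonLIE (𝕜 := ℂ) (E := E) (F := ℂ)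
    (0 : Fin 1)).toContinuousLinearEquiv.differentiableAt.comp y hcomp

/-- **Differentiability of `y ↦ b(y) · (dz₀ ∧ dz₁) ∘ L(y)`** in the space of `ℂ`-linear
`2`-forms. [folklore] -/
theorem differentiableAt_twoFormℂ {X : Type*} [NormedAddCommGroup X] [NormedSpace ℂ X]
    {b : X → ℂ} {L : X → E →L[ℂ] (Fin 2 → ℂ)} {y : X}
    (hb : DifferentiableAt ℂ b y) (hL : ContDiffAt ℂ 1 L y) :
    DifferentiableAt ℂ (fun y ↦ twoFormℂ (b y) (L y)) y := by
  have h2 : DifferentiableAt ℂ (fun y ↦ dzWedgeℂ.compContinuousLinearMap (L y)) y :=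
    (ContDiffAt.continuousAlternatingMapCompContinuousLinearMap contDiffAt_const
      hL).differentiableAt one_ne_zero
  exact hb.smul h2

end ModelForms

end BallForms

namespace UnitaryBallUniformisationDatum

variable {X₂ : Motives.SchemeOver ℂ} (D : UnitaryBallUniformisationDatum 2 X₂) (A : HodgeModel 2 X₂)
  (𝔣 : D.SylvesterFrame)

/-- The covector `η̃_z = Σᵢ Fᵢ(z) dzᵢ ∘ (dψ_z)⁻¹` on `T_{ψ z} X^an = A.model` attached to
`F : 𝔹² → ℂ²` at the ball point `z`. [cite: Borel1997, §5.14] -/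
def descForm₁ (F : Ball → (Fin 2 → ℂ)) (z : Ball) : A.model [⋀^Fin 1]→L[ℝ] ℂ :=
  BallForms.covec (F z) ((D.unifDerivEquiv A 𝔣 z).symm : A.model →L[ℝ] (Fin 2 → ℂ))

/-- Evaluation of `descForm₁`. [folklore] -/
@[simp] theorem descForm₁_apply (F : Ball → (Fin 2 → ℂ)) (z : Ball) (v : Fin 1 → A.model) :
    D.descForm₁ A 𝔣 F z v = ∑ i, F z i * (D.unifDerivEquiv A 𝔣 z).symm (v 0) i :=
  BallForms.covec_apply _ _ v

/-- The `2`-form `G(z) (dz₀ ∧ dz₁) ∘ (dψ_z)⁻¹` on `T_{ψ z} X^an` attached to `G : 𝔹² → ℂ` at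
`z`. [cite: Borel1997, §5.14] -/
def descForm₂ (G : Ball → ℂ) (z : Ball) : A.model [⋀^Fin 2]→L[ℝ] ℂ :=
  BallForms.twoForm (G z) ((D.unifDerivEquiv A 𝔣 z).symm : A.model →L[ℝ] (Fin 2 → ℂ))

/-- Evaluation of `descForm₂`. [folklore] -/
@[simp] theorem descForm₂_apply (G : Ball → ℂ) (z : Ball) (v : Fin 2 → A.model) :
    D.descForm₂ A 𝔣 G z v = G z *
      ((D.unifDerivEquiv A 𝔣 z).symm (v 0) 0 * (D.unifDerivEquiv A 𝔣 z).symm (v 1) 1 -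
        (D.unifDerivEquiv A 𝔣 z).symm (v 1) 0 * (D.unifDerivEquiv A 𝔣 z).symm (v 0) 1) :=
  BallForms.twoForm_apply _ _ v

variable {D A 𝔣}

/-- **`Γ`-invariance in degree `1`**: `η̃_{γ z} = η̃_z` for a form of cotangent type
(`F(z) = J(γ,z)ᵀ F(γ z)` and `(dψ_{γ z})⁻¹ = J(γ,z) (dψ_z)⁻¹`). [cite: Borel1997, §5.14] -/
theorem descForm₁_smul {F : Ball → (Fin 2 → ℂ)}
    (hF : F ∈ factorForms ((⊤ : Subgroup D.Γ).map (D.ballRep 𝔣)) BallForms.cotangentCocycle)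
    (γ : D.Γ) (z : Ball) :
    D.descForm₁ A 𝔣 F (D.ballRep 𝔣 γ • z) = D.descForm₁ A 𝔣 F z := by
  ext v
  have hFz : F z = (Jac (D.ballRep 𝔣 γ) z)ᵀ *ᵥ F (D.ballRep 𝔣 γ • z) := by
    have h := hF (D.ballRep 𝔣 γ) (Subgroup.mem_map_of_mem _ (Subgroup.mem_top γ)) z
    rwa [BallForms.cotangentCocycle_apply] at h
  rw [descForm₁_apply, descForm₁_apply, unifDerivEquiv_symm_smul_point, hFz]
  change F (D.ballRep 𝔣 γ • z) ⬝ᵥ (Jac (D.ballRep 𝔣 γ) z *ᵥ _) =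
    ((Jac (D.ballRep 𝔣 γ) z)ᵀ *ᵥ F (D.ballRep 𝔣 γ • z)) ⬝ᵥ _
  rw [dotProduct_mulVec, mulVec_transpose]

/-- **`Γ`-invariance in degree `2`**: for a form of canonical type (`G(z) = det J(γ,z) G(γ z)`).
[cite: Borel1997, §5.14] -/
theorem descForm₂_smul {G : Ball → ℂ}
    (hG : G ∈ factorForms ((⊤ : Subgroup D.Γ).map (D.ballRep 𝔣)) (BallForms.canonicalCocycle ℂ 1))
    (γ : D.Γ) (z : Ball) :
    D.descForm₂ A 𝔣 G (D.ballRep 𝔣 γ • z) = D.descForm₂ A 𝔣 G z := by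
  ext v
  have hGz : G z = (Jac (D.ballRep 𝔣 γ) z).det * G (D.ballRep 𝔣 γ • z) := by
    have h := hG (D.ballRep 𝔣 γ) (Subgroup.mem_map_of_mem _ (Subgroup.mem_top γ)) z
    rwa [BallForms.canonicalCocycle_apply, pow_one, smul_eq_mul] at h
  rw [descForm₂_apply, descForm₂_apply, unifDerivEquiv_symm_smul_point,
    unifDerivEquiv_symm_smul_point, hGz]
  simp only [Matrix.mulVec, dotProduct, Fin.sum_univ_two, Matrix.det_fin_two]
  ring

variable (D A 𝔣)

/-- A chosen preimage under `ψ` of a point of `X^an`. [folklore] -/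
def sec (x : A.carrier) : Ball := (D.exists_modelUnif_eq A 𝔣 x).choose

/-- `ψ (sec x) = x`. [folklore] -/
theorem modelUnif_sec (x : A.carrier) : D.modelUnif A 𝔣 (D.sec A 𝔣 x).1 = x :=
  (D.exists_modelUnif_eq A 𝔣 x).choose_spec

/-- The chosen preimage of `ψ z` is a `Γ`-translate of `z`. [folklore] -/
theorem exists_smul_sec_eq (z : Ball) :
    ∃ γ : D.Γ, D.ballRep 𝔣 γ • D.sec A 𝔣 (D.modelUnif A 𝔣 z.1) = z :=
  (D.modelUnif_eq_iff A 𝔣 _ _).1 (D.modelUnif_sec A 𝔣 _)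

/-- **The descended `1`-form** `η_F` on `X^an`: `(η_F)_x = η̃_z` for the chosen `z` over `x`.
[cite: Borel1997, §5.14] -/
def descMForm₁ (F : Ball → (Fin 2 → ℂ)) : MForm 𝓘(ℝ, A.model) A.carrier ℂ 1 :=
  fun x ↦ D.descForm₁ A 𝔣 F (D.sec A 𝔣 x)

/-- **The descended `2`-form** `η_G` on `X^an`. [cite: Borel1997, §5.14] -/
def descMForm₂ (G : Ball → ℂ) : MForm 𝓘(ℝ, A.model) A.carrier ℂ 2 :=
  fun x ↦ D.descForm₂ A 𝔣 G (D.sec A 𝔣 x)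

variable {D A 𝔣}

/-- `(η_F)_{ψ z} = η̃_z` for EVERY `z` (invariance). [cite: Borel1997, §5.14] -/
theorem descMForm₁_modelUnif {F : Ball → (Fin 2 → ℂ)}
    (hF : F ∈ factorForms ((⊤ : Subgroup D.Γ).map (D.ballRep 𝔣)) BallForms.cotangentCocycle)
    (z : Ball) : D.descMForm₁ A 𝔣 F (D.modelUnif A 𝔣 z.1) = D.descForm₁ A 𝔣 F z := by
  obtain ⟨γ, hγ⟩ := D.exists_smul_sec_eq A 𝔣 z
  conv_rhs => rw [← hγ, descForm₁_smul hF]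
  rfl

/-- `(η_G)_{ψ z} = G(z) (dz₀ ∧ dz₁) ∘ (dψ_z)⁻¹` for every `z`. [cite: Borel1997, §5.14] -/
theorem descMForm₂_modelUnif {G : Ball → ℂ}
    (hG : G ∈ factorForms ((⊤ : Subgroup D.Γ).map (D.ballRep 𝔣)) (BallForms.canonicalCocycle ℂ 1))
    (z : Ball) : D.descMForm₂ A 𝔣 G (D.modelUnif A 𝔣 z.1) = D.descForm₂ A 𝔣 G z := by
  obtain ⟨γ, hγ⟩ := D.exists_smul_sec_eq A 𝔣 z
  conv_rhs => rw [← hγ, descForm₂_smul hG]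
  rfl

/-- **The descended `1`-form of a holomorphic automorphic form is holomorphic in charts.** In the
chart at `ψ z`, with `g` the holomorphic local inverse of `ψ`, its representative is
`y ↦ Σᵢ Fᵢ(g y) dzᵢ ∘ dg_y`, a complex-differentiable (hence analytic, by Osgood's lemma) germ of
`ℂ`-linear forms. [cite: VoisinHodgeI2002, §2.3.1] -/
theorem isHolomorphicInCharts_descMForm₁ {F : Ball → (Fin 2 → ℂ)}
    (hF : F ∈ D.holAutForms 𝔣 ⊤ BallForms.cotangentCocycle) :
    IsHolomorphicInCharts (D.descMForm₁ A 𝔣 F) := by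
  obtain ⟨hF1, hF2⟩ := BallForms.mem_holFactorForms_iff.1 hF
  intro x₀
  obtain ⟨z₀, hz₀⟩ := D.exists_modelUnif_eq A 𝔣 x₀
  subst hz₀
  obtain ⟨c⟩ := D.nonempty_chartInverse A 𝔣 z₀
  set Fext := BallForms.extend (Fin 2 → ℂ) F with hFext
  have hgan : AnalyticOnNhd ℂ c.g c.W := fun y hy ↦
    SCV.analyticAt_of_differentiableOn c.differentiableOn c.isOpen hy
  refine ⟨fun y ↦ BallForms.covecℂ (Fext (c.g y)) (fderiv ℂ c.g y), ?_, ?_⟩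
  · have hd : DifferentiableOn ℂ
        (fun y ↦ BallForms.covecℂ (Fext (c.g y)) (fderiv ℂ c.g y)) c.W := by
      intro y hy
      have h1 : DifferentiableAt ℂ (fun y ↦ Fext (c.g y)) y :=
        (BallForms.differentiableAt_extend hF2 (c.gBall hy)).comp y (c.differentiableAt hy)
      have h2 : DifferentiableAt ℂ (fderiv ℂ c.g) y := ((hgan y hy).fderiv).differentiableAt
      exact (BallForms.differentiableAt_covecℂ h1 h2).differentiableWithinAt
    exact SCV.analyticAt_of_differentiableOn hd c.isOpen c.center_mem
  · filter_upwards [c.isOpen.mem_nhds c.center_mem] with y hy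
    ext v
    have hpt : D.descMForm₁ A 𝔣 F
        ((extChartAt 𝓘(ℝ, A.model) (D.modelUnif A 𝔣 z₀.1)).symm y) =
        D.descForm₁ A 𝔣 F (c.gBall hy) := by
      rw [c.symm_eq y hy]
      exact descMForm₁_modelUnif hF1 (c.gBall hy)
    have hFg : Fext (c.g y) = F (c.gBall hy) := BallForms.extend_apply_coe F (c.gBall hy)
    rw [Literature.Geometry.Kaehler.MForm.inChart_apply, hpt, BallForms.restrictScalars_covecℂ,
      c.fderiv_restrictScalars hy, hFg]
    change D.descForm₁ A 𝔣 F (c.gBall hy) (fun i ↦ mfderivWithin 𝓘(ℝ, A.model) 𝓘(ℝ, A.model)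
        (extChartAt 𝓘(ℝ, A.model) (D.modelUnif A 𝔣 z₀.1)).symm (range 𝓘(ℝ, A.model)) y (v i)) =
      BallForms.covec (F (c.gBall hy)) (fderiv ℝ c.g y) v
    simp only [descForm₁_apply, BallForms.covec_apply, c.symm_mfderivWithin_symm_apply hy]

/-- **The descended `2`-form of a holomorphic automorphic form of canonical type is holomorphic
in charts** (representative `y ↦ G(g y) (dz₀ ∧ dz₁) ∘ dg_y`). [cite: VoisinHodgeI2002, §2.3.1] -/
theorem isHolomorphicInCharts_descMForm₂ {G : Ball → ℂ}
    (hG : G ∈ D.holAutForms 𝔣 ⊤ (BallForms.canonicalCocycle ℂ 1)) :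
    IsHolomorphicInCharts (D.descMForm₂ A 𝔣 G) := by
  obtain ⟨hG1, hG2⟩ := BallForms.mem_holFactorForms_iff.1 hG
  intro x₀
  obtain ⟨z₀, hz₀⟩ := D.exists_modelUnif_eq A 𝔣 x₀
  subst hz₀
  obtain ⟨c⟩ := D.nonempty_chartInverse A 𝔣 z₀
  set Gext := BallForms.extend ℂ G with hGext
  have hgan : AnalyticOnNhd ℂ c.g c.W := fun y hy ↦
    SCV.analyticAt_of_differentiableOn c.differentiableOn c.isOpen hy
  refine ⟨fun y ↦ BallForms.twoFormℂ (Gext (c.g y)) (fderiv ℂ c.g y), ?_, ?_⟩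
  · have hd : DifferentiableOn ℂ
        (fun y ↦ BallForms.twoFormℂ (Gext (c.g y)) (fderiv ℂ c.g y)) c.W := by
      intro y hy
      have h1 : DifferentiableAt ℂ (fun y ↦ Gext (c.g y)) y :=
        (BallForms.differentiableAt_extend hG2 (c.gBall hy)).comp y (c.differentiableAt hy)
      have h2 : ContDiffAt ℂ 1 (fderiv ℂ c.g) y := ((hgan y hy).fderiv).contDiffAt
      exact (BallForms.differentiableAt_twoFormℂ h1 h2).differentiableWithinAt
    exact SCV.analyticAt_of_differentiableOn hd c.isOpen c.center_mem
  · filter_upwards [c.isOpen.mem_nhds c.center_mem] with y hy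
    ext v
    have hpt : D.descMForm₂ A 𝔣 G
        ((extChartAt 𝓘(ℝ, A.model) (D.modelUnif A 𝔣 z₀.1)).symm y) =
        D.descForm₂ A 𝔣 G (c.gBall hy) := by
      rw [c.symm_eq y hy]
      exact descMForm₂_modelUnif hG1 (c.gBall hy)
    have hGg : Gext (c.g y) = G (c.gBall hy) := BallForms.extend_apply_coe G (c.gBall hy)
    rw [Literature.Geometry.Kaehler.MForm.inChart_apply, hpt, BallForms.restrictScalars_twoFormℂ,
      c.fderiv_restrictScalars hy, hGg]
    change D.descForm₂ A 𝔣 G (c.gBall hy) (fun i ↦ mfderivWithin 𝓘(ℝ, A.model) 𝓘(ℝ, A.model)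
        (extChartAt 𝓘(ℝ, A.model) (D.modelUnif A 𝔣 z₀.1)).symm (range 𝓘(ℝ, A.model)) y (v i)) =
      BallForms.twoForm (G (c.gBall hy)) (fderiv ℝ c.g y) v
    simp only [descForm₂_apply, BallForms.twoForm_apply, c.symm_mfderivWithin_symm_apply hy]

/-- **`ψ^* η_F = F`**: the pull-back of the descended form is the automorphic form.
[cite: Borel1997, §5.14] -/
theorem formPullback₁_descMForm₁ {F : Ball → (Fin 2 → ℂ)}
    (hF : F ∈ factorForms ((⊤ : Subgroup D.Γ).map (D.ballRep 𝔣)) BallForms.cotangentCocycle) :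
    D.formPullback₁ A 𝔣 (D.descMForm₁ A 𝔣 F) = F := by
  funext z i
  rw [formPullback₁_apply, descMForm₁_modelUnif hF z]
  change D.descForm₁ A 𝔣 F z (fun _ ↦ D.unifDeriv A 𝔣 z.1 (Pi.single i 1)) = F z i
  simp only [descForm₁_apply, symm_unifDeriv_apply]
  change F z ⬝ᵥ Pi.single i 1 = F z i
  rw [dotProduct_single, mul_one]

/-- **`ψ^* η_G = G`** in degree `2`. [cite: Borel1997, §5.14] -/
theorem formPullback₂_descMForm₂ {G : Ball → ℂ}
    (hG : G ∈ factorForms ((⊤ : Subgroup D.Γ).map (D.ballRep 𝔣)) (BallForms.canonicalCocycle ℂ 1)) :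
    D.formPullback₂ A 𝔣 (D.descMForm₂ A 𝔣 G) = G := by
  funext z
  rw [formPullback₂_apply, descMForm₂_modelUnif hG z]
  change D.descForm₂ A 𝔣 G z
      ![D.unifDeriv A 𝔣 z.1 (Pi.single 0 1), D.unifDeriv A 𝔣 z.1 (Pi.single 1 1)] = G z
  simp [symm_unifDeriv_apply]

variable (D A 𝔣)

/-- **Descent, degree `1`**: every holomorphic automorphic form of cotangent type for `Γ` is the
pull-back of a holomorphic `1`-form on `X^an` — the pull-back map
`Ω¹(X^an) → 𝒜_hol(Γ, J⁻ᵀ)` is surjective. [cite: Borel1997, §5.14] -/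
theorem holFormPullback₁_surjective : Function.Surjective (D.holFormPullback₁ A 𝔣 ⊤) := by
  intro F
  refine ⟨⟨D.descMForm₁ A 𝔣 F, isHolomorphicInCharts_descMForm₁ F.2⟩, Subtype.ext ?_⟩
  rw [coe_holFormPullback₁]
  exact formPullback₁_descMForm₁ (BallForms.mem_holFactorForms_iff.1 F.2).1

/-- **Descent, degree `2`**: the pull-back map `Ω²(X^an) → 𝒜_hol(Γ, det J⁻¹)` is surjective.
[cite: Hirzebruch1966, §22.2] -/
theorem holFormPullback₂_surjective : Function.Surjective (D.holFormPullback₂ A 𝔣 ⊤) := by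
  intro G
  refine ⟨⟨D.descMForm₂ A 𝔣 G, isHolomorphicInCharts_descMForm₂ G.2⟩, Subtype.ext ?_⟩
  rw [coe_holFormPullback₂]
  exact formPullback₂_descMForm₂ (BallForms.mem_holFactorForms_iff.1 G.2).1

end UnitaryBallUniformisationDatum

end Literature.AlgebraicGeometry.ShimuraVarieties

end
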